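import Literature.NumberTheory.EllipticCurves.TwoDescentRankBounds
import HarnessLib

/-!
# BirchSwinnertonDyer — rank ≥ 2 observatory: counting lemma `2^(rank + 1) ≤ #ψ(A)` with ONE torsion point

HONEST FRAMING: per-curve certified theorems and census instruments; no claim on BSD in rank ≥ 2.

Generic piece (M3) of the successor instrument KERNEL-2DESC-Z2 (design
`b2b-bsdr2-cert-3/KERNEL-TRANSPORT.md` § "Successor design … KERNEL-2DESC-Z2"): the complete
`2`-descent of a curve with `E(ℚ)[2] = ℤ/2` needs the count `#E(ℚ)/2E(ℚ) = 2^{rank+1}`, i.e. the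
`+1` sibling of the tree's `pow_finrank_add_two_le_natCard_range` (two torsion points, `+2`,
`Literature/NumberTheory/EllipticCurves/TwoDescentRankBounds.lean`) and of the torsion-blind
`two_pow_finrank_le_natCard_range` of the cubic-field instrument (`…2DescMuMap.lean`):
for a finitely generated abelian group `A`, an additive `ψ : A → V` with `ker ψ ⊆ 2A` and ONE element
`t` of finite order with `ψ t ≠ 0`, the image has at least `2^(rank_ℤ A + 1)` elements
(`A ↠ (A/A_tors)/2 ≅ (ℤ/2)^r` factors through `A/ker ψ ≅ ψ(A)` and the factored map kills the two
distinct classes of `0` and `t`). Proof = the tree's `+2` proof with two classes instead of four.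
Sorry-free; axioms `propext`, `Classical.choice`, `Quot.sound`.
[cite: SilvermanAEC2009, Prop. X.1.4] (the algebra of `#E(K)/2E(K) = 2^r · #E(K)[2]`, AEC VIII.§1)
-/

-- single-conjunct summit: `Summit.BirchSwinnertonDyer.BirchSwinnertonDyer.…` repeats the name by design
set_option linter.dupNamespace false

noncomputable section

open scoped Classical

namespace Summit.BirchSwinnertonDyer.BirchSwinnertonDyer.Rank2Observatory.TwoDescZ2

variable {A V : Type*} [AddCommGroup A] [AddCommGroup V]

/-- **`2 ^ (rank_ℤ A + 1) ≤ #ψ(A)`.** `A` finitely generated abelian, `ψ : A → V` additive with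
`ψ a = 0 → a ∈ 2A`, and `t ∈ A` of finite order with `ψ t ≠ 0`. Then `ψ(A)`, if finite, has at
least `2 ^ (rank_ℤ A + 1)` elements. [cite: SilvermanAEC2009, Prop. X.1.4] -/
theorem pow_finrank_add_one_le_natCard_range [Module.Finite ℤ A] (ψ : A →+ V)
    (hker : ∀ a, ψ a = 0 → ∃ b, a = 2 • b) {t : A} (ht : IsOfFinAddOrder t) (h₁ : ψ t ≠ 0)
    [Finite ψ.range] :
    2 ^ (Module.finrank ℤ A + 1) ≤ Nat.card ψ.range := by
  set T := AddCommGroup.torsion A with hT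
  let π : A →ₗ[ℤ] A ⧸ T := (QuotientAddGroup.mk' T).toIntLinearMap
  have hπ : Function.Surjective π := QuotientAddGroup.mk'_surjective T
  haveI : Module.Finite ℤ (A ⧸ T) := Module.Finite.of_surjective π hπ
  haveI : NoZeroSMulDivisors ℤ (A ⧸ T) := inferInstance
  haveI : Module.Free ℤ (A ⧸ T) := Module.free_of_finite_type_torsion_free'
  have hrank : Module.finrank ℤ (A ⧸ T) = Module.finrank ℤ A := by
    have hker' : LinearMap.ker π ≤ Submodule.torsion ℤ A := by
      intro x hx
      have hx' : x ∈ T := (QuotientAddGroup.eq_zero_iff x).mp (LinearMap.mem_ker.mp hx)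
      rwa [hT, ← Submodule.torsion_int] at hx'
    rw [← (π.quotKerEquivOfSurjective hπ).finrank_eq]
    exact finrank_quotient_eq_of_le_torsion hker'
  -- `g : A → (A/T)/2`, surjective, kills `ker ψ` and `T`
  let g : A →+ ModN (A ⧸ T) 2 := (ModN.mkQ 2).comp (QuotientAddGroup.mk' T)
  have hg : Function.Surjective g :=
    (Submodule.mkQ_surjective _).comp (QuotientAddGroup.mk'_surjective T)
  have hgT : ∀ t ∈ T, g t = 0 := fun t ht => by
    change ModN.mkQ 2 (QuotientAddGroup.mk' T t) = 0
    rw [QuotientAddGroup.mk'_apply, (QuotientAddGroup.eq_zero_iff t).mpr ht, map_zero]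
  have hle : ψ.ker ≤ g.ker := by
    intro a ha
    obtain ⟨b, rfl⟩ := hker a ha
    rw [AddMonoidHom.mem_ker]
    change ModN.mkQ 2 (QuotientAddGroup.mk' T (2 • b)) = 0
    rw [map_nsmul, ← natCast_zsmul]
    exact (Submodule.Quotient.mk_eq_zero _).mpr ⟨QuotientAddGroup.mk' T b, rfl⟩
  let Φ : A ⧸ ψ.ker →+ ModN (A ⧸ T) 2 := QuotientAddGroup.lift _ g hle
  have hΦ : Function.Surjective Φ := by
    intro y
    obtain ⟨a, rfl⟩ := hg y
    exact ⟨QuotientAddGroup.mk a, QuotientAddGroup.lift_mk _ hle a⟩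
  -- `A / ker ψ ≅ ψ(A)` is finite
  let e : A ⧸ ψ.ker ≃+ ψ.range := QuotientAddGroup.quotientKerEquivRange ψ
  haveI : Finite (A ⧸ ψ.ker) := Finite.of_equiv _ e.toEquiv.symm
  rw [← Nat.card_congr e.toEquiv]
  -- two distinct elements of `ker Φ`
  have hmemT : ∀ t, IsOfFinAddOrder t → (QuotientAddGroup.mk t : A ⧸ ψ.ker) ∈ Φ.ker := by
    intro t ht
    rw [AddMonoidHom.mem_ker]
    change Φ (QuotientAddGroup.mk t) = 0
    rw [QuotientAddGroup.lift_mk _ hle]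
    exact hgT t ht
  have hmk : ∀ a b : A, (QuotientAddGroup.mk a : A ⧸ ψ.ker) = QuotientAddGroup.mk b ↔
      ψ a = ψ b := by
    intro a b
    rw [QuotientAddGroup.eq, AddMonoidHom.mem_ker, map_add, map_neg, neg_add_eq_zero, eq_comm]
  have hcard2 : 2 ≤ Nat.card Φ.ker := by
    let q : A → A ⧸ ψ.ker := QuotientAddGroup.mk
    have hsub : ({q 0, q t} : Set (A ⧸ ψ.ker)) ⊆ Φ.ker := by
      intro x hx
      simp only [Set.mem_insert_iff, Set.mem_singleton_iff] at hx
      rcases hx with rfl | rfl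
      · exact hmemT 0 IsOfFinAddOrder.zero
      · exact hmemT t ht
    have h2 : ({q 0, q t} : Set (A ⧸ ψ.ker)).ncard = 2 := by
      have e01 : q 0 ≠ q t := fun h => h₁ (by rw [hmk, map_zero] at h; exact h.symm)
      exact Set.ncard_pair e01
    have hle2 := Set.ncard_le_ncard hsub (Set.toFinite _)
    rw [h2] at hle2
    rw [← SetLike.coe_sort_coe, Nat.card_coe_set_eq]
    exact hle2
  have hprod := AddSubgroup.card_eq_card_quotient_mul_card_addSubgroup Φ.ker
  rw [Nat.card_congr (QuotientAddGroup.quotientKerEquivOfSurjective Φ hΦ).toEquiv,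
    ModN.natCard_eq, hrank] at hprod
  rw [hprod, pow_add, pow_one]
  exact Nat.mul_le_mul_left _ hcard2

/-- **Rank bound, `ℤ/2`-torsion form.** If moreover `ψ(A) ⊆ S` for a finite set `S` with
`#S < 2^(s+2)`, then `rank_ℤ A ≤ s` (the order of `A/2A` is a power of `2`, so a
non-sharp cover still bounds the rank as long as it stays below the next power of `2`). [cite: SilvermanAEC2009, Prop. X.1.4] -/
theorem finrank_le_of_range_subset [Module.Finite ℤ A] (ψ : A →+ V)
    (hker : ∀ a, ψ a = 0 → ∃ b, a = 2 • b) {t : A} (ht : IsOfFinAddOrder t) (h₁ : ψ t ≠ 0)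
    (S : Finset V) (hS : ∀ a, ψ a ∈ S) {s : ℕ} (hcard : S.card < 2 ^ (s + 2)) :
    Module.finrank ℤ A ≤ s := by
  have hsub : (ψ.range : Set V) ⊆ ↑S := by
    rintro _ ⟨a, rfl⟩
    exact hS a
  haveI : Finite ψ.range := Set.Finite.subset S.finite_toSet hsub
  have h := pow_finrank_add_one_le_natCard_range ψ hker ht h₁
  have hle : Nat.card ψ.range ≤ S.card := by
    rw [← SetLike.coe_sort_coe, Nat.card_coe_set_eq, ← Set.ncard_coe_finset]
    exact Set.ncard_le_ncard hsub S.finite_toSet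
  have key : 2 ^ (Module.finrank ℤ A + 1) < 2 ^ (s + 2) := lt_of_le_of_lt (h.trans hle) hcard
  have := (Nat.pow_lt_pow_iff_right (by norm_num)).mp key
  omega

end Summit.BirchSwinnertonDyer.BirchSwinnertonDyer.Rank2Observatory.TwoDescZ2

end
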